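import Summits.PneNP.PneNP.Theorems.SymmetryBudgetWindowBarrierEntropySupportTheorem
import Summits.PneNP.PneNP.Theorems.SymmetryBudgetWindowBarrierCoreFoolingCapstone
import Summits.PneNP.PneNP.Theorems.SymmetryBudgetNoHiddenOrderIffNotWindowBarrier
import Summits.PneNP.PneNP.Theorems.SymmetryBudgetWindowBarrierCosetGame

/-!
# Entropy games: a sound Duplicator criterion for the exponential window
(dichotomy `WindowBarrier` stmt-PneNP-2145 / `NoHiddenOrder` stmt-PneNP-14781, route `PneNP/SymmetryBudget`)

The items' informal text asks for "an invariant of symmetric circuits with orbits in `(2^g, g!)`":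
the support theorems (Anderson–Dawar, Dawar–Wilsenach Thm. 6.4, both proved in the tree) give
`C^k`-invariance only up to orbit size `2^{o(n)}`.  This file supplies the invariant for orbit size
`2^{O(n)}` — the window — by combining

* the entropy support theorem `entropySupportTheorem` (landed, stmt-PneNP-2145): a subgroup of
  `Sym(Fin n)` of index `≤ 2^{cn}` contains every 3-cycle inside the classes of a labelling `μ` of
  entropy `≤ K n` (`n! ≤ 2^{Kn} ∏ |class|!`), `K = K(c)`;
* the coset-game invariance principle `CosetGame.eval_eq_of_game`
  (`SymmetryBudgetWindowBarrierCosetGame.lean`): gates stabilised by subgroups `A j` are fooled by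
  relabelling pairs related in a game whose moves are bijections of `A j`.

Content:
* `CosetGame.autStab C j` — the automorphism-stabiliser of a gate as a SUBGROUP (automorphisms of
  straight-line circuits compose and invert, via the DAG reading `GateDAG.ofCircuit`), with the
  rigidity-free orbit bound `index_autStab_le : (autStab C j).index ≤ C.size` for `Sym(Fin n)`-symmetric
  `C`, and `autStab_output` (the output gate is stabilised by everything).
* `CosetGame.blockGroup μ` (the group generated by the equally-labelled 3-cycles, `= ∏ Alt(class)`),
  `CosetGame.IsLowEntropy K μ`, and the structure `CosetGame.EntropyGame K G H`: relations at block
  positions (types `μ` of entropy `≤ K n`) and at point positions (input pairs), adjacency-preserving at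
  points, inhabited at the one-block type, closed under block→block and block→point moves given by
  bijections of `blockGroup μ`.
* **`CosetGame.eval_eq_of_entropyGame`**: `∀ c ∃ K`, an entropy-`K` game between `G` and `H` forces
  every `Sym(Fin n)`-symmetric `tcBasis`-circuit with `≤ 2^{cn}` gates to accept `G` iff it accepts `H`.
* Consequences in the crux's vocabulary: `coreFooling_of_entropyGames` ((★) CoreFooling from games
  for every `K` on non-isomorphic pairs, infinitely often), `hardToIdentify_of_entropyGames` (the open
  core `stub_hardToIdentify`), `windowBarrier_of_entropyGames` (with `babaiLuks1983_canonicalForm`: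
  `WindowBarrier`, i.e. `¬ NoHiddenOrder`).

So a proof of `WindowBarrier` / refutation of `NoHiddenOrder` along the picked line now needs
exactly: Babai–Luks canonical forms (literature debt) and, for every `K`, infinitely many
non-isomorphic pairs with an entropy-`K` game — a purely group-combinatorial Duplicator condition in
which circuits no longer appear.  Completeness of the game (the converse compilation) is not claimed
here.
-/

-- `Summit.PneNP.PneNP.…` duplicates `PneNP` BY DESIGN (single-problem summit).
set_option linter.dupNamespace false

namespace Summit.PneNP.PneNP.Theorems

open Finset Filter Literature.Computability.Complexity Literature.ModelTheory.FiniteModelTheory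

namespace CosetGame

variable {n : ℕ}

/-! ### Automorphisms compose: the automorphism-stabiliser of a gate is a subgroup -/

/-- Automorphisms over `a × a` and `b × b` compose to an automorphism over `(ab) × (ab)`. -/
theorem isInducedAut_mul (C : Circuit (Fin n × Fin n)) {a b : Equiv.Perm (Fin n)}
    {σ τ : Equiv.Perm (Fin C.gates.length)}
    (ha : C.IsInducedAut (fun q : Fin n × Fin n => (a q.1, a q.2)) σ)
    (hb : C.IsInducedAut (fun q : Fin n × Fin n => (b q.1, b q.2)) τ) :
    C.IsInducedAut (fun q : Fin n × Fin n => ((a * b) q.1, (a * b) q.2)) (σ * τ) := by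
  rw [GateDAG.isInducedAut_iff_isAut_ofCircuit] at ha hb ⊢
  exact hb.trans _ ha

/-- The inverse of an automorphism over `a × a` is an automorphism over `a⁻¹ × a⁻¹`. -/
theorem isInducedAut_inv (C : Circuit (Fin n × Fin n)) {a : Equiv.Perm (Fin n)}
    {σ : Equiv.Perm (Fin C.gates.length)}
    (ha : C.IsInducedAut (fun q : Fin n × Fin n => (a q.1, a q.2)) σ) :
    C.IsInducedAut (fun q : Fin n × Fin n => (a⁻¹ q.1, a⁻¹ q.2)) σ⁻¹ := by
  rw [GateDAG.isInducedAut_iff_isAut_ofCircuit] at ha ⊢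
  have hdiag : (fun q : Fin n × Fin n => (a q.1, a q.2)) = ⇑(Equiv.prodCongr a a) :=
    funext fun _ => rfl
  rw [hdiag] at ha
  exact ha.symm

/-- **The automorphism-stabiliser of gate `j`**: the permutations `ρ` of `Fin n` such that SOME
automorphism of `C` over `ρ × ρ` fixes `j` (`Circuit.gateStabiliser Set.univ`, as a subgroup:
automorphisms compose and invert). -/
def autStab (C : Circuit (Fin n × Fin n)) (j : Fin C.gates.length) : Subgroup (Equiv.Perm (Fin n)) where
  carrier := {ρ | ∃ σ : Equiv.Perm (Fin C.gates.length),
    C.IsInducedAut (fun q : Fin n × Fin n => (ρ q.1, ρ q.2)) σ ∧ σ j = j}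
  mul_mem' := by
    rintro a b ⟨σ, hσ, hσj⟩ ⟨τ, hτ, hτj⟩
    exact ⟨σ * τ, isInducedAut_mul C hσ hτ, by rw [Equiv.Perm.mul_apply, hτj, hσj]⟩
  one_mem' := by
    refine ⟨1, ?_, rfl⟩
    have h : (fun q : Fin n × Fin n =>
        ((1 : Equiv.Perm (Fin n)) q.1, (1 : Equiv.Perm (Fin n)) q.2)) = _root_.id :=
      funext fun _ => rfl
    rw [h]
    exact C.isInducedAut_id_one
  inv_mem' := by
    rintro a ⟨σ, hσ, hσj⟩
    refine ⟨σ⁻¹, isInducedAut_inv C hσ, ?_⟩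
    rw [Equiv.Perm.inv_def, Equiv.symm_apply_eq]
    exact hσj.symm

/-- Membership in `autStab`, unfolded. -/
theorem mem_autStab_iff (C : Circuit (Fin n × Fin n)) (j : Fin C.gates.length) (ρ : Equiv.Perm (Fin n)) :
    ρ ∈ autStab C j ↔ ∃ σ : Equiv.Perm (Fin C.gates.length),
      C.IsInducedAut (fun q : Fin n × Fin n => (ρ q.1, ρ q.2)) σ ∧ σ j = j := Iff.rfl

/-- **Orbit–stabiliser bound without rigidity**: in a `Sym(Fin n)`-symmetric circuit the
automorphism-stabiliser of a gate has index at most the number of gates.  (Choose one automorphism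
`σ_ρ` over every `ρ`; `ρ ↦ σ_ρ j` separates the left cosets of `autStab C j`: if
`σ_{ρ₁} j = σ_{ρ₂} j` then `σ_{ρ₁}⁻¹ σ_{ρ₂}` is an automorphism over `ρ₁⁻¹ ρ₂` fixing `j`.) -/
theorem index_autStab_le (C : Circuit (Fin n × Fin n)) (hsymC : C.IsSymmetricUnder Set.univ)
    (j : Fin C.gates.length) : (autStab C j).index ≤ C.size := by
  classical
  choose σ hσ using fun ρ : Equiv.Perm (Fin n) => hsymC ρ (Set.mem_univ ρ)
  let ψ : (Equiv.Perm (Fin n) ⧸ autStab C j) → Fin C.gates.length := fun q => σ q.out j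
  have hψ : Function.Injective ψ := by
    intro q₁ q₂ h
    change σ q₁.out j = σ q₂.out j at h
    rw [← QuotientGroup.out_eq' q₁, ← QuotientGroup.out_eq' q₂, QuotientGroup.eq]
    refine ⟨(σ q₁.out)⁻¹ * σ q₂.out, isInducedAut_mul C (isInducedAut_inv C (hσ _)) (hσ _), ?_⟩
    rw [Equiv.Perm.mul_apply, ← h]
    simp
  calc (autStab C j).index = Nat.card (Equiv.Perm (Fin n) ⧸ autStab C j) := rfl
    _ ≤ Nat.card (Fin C.gates.length) := Nat.card_le_card_of_injective ψ hψ
    _ = C.size := by simp [Circuit.size]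

/-- Every permutation stabilises the output gate of a symmetric circuit. -/
theorem autStab_output (C : Circuit (Fin n × Fin n)) (hsymC : C.IsSymmetricUnder Set.univ)
    {j : Fin C.gates.length} (hout : C.output = Sum.inr (j : ℕ)) : autStab C j = ⊤ := by
  refine (Subgroup.eq_top_iff' _).2 fun ρ => ?_
  obtain ⟨σ, hσ⟩ := hsymC ρ (Set.mem_univ _)
  refine ⟨σ, hσ, ?_⟩
  have h1 := hσ.1
  rw [hout, Circuit.relabelWire_inr, Circuit.relabelGate_of_lt σ j.2, Sum.inr.injEq] at h1
  exact Fin.ext h1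

/-! ### Bounded-entropy labellings and their block groups -/

/-- **The block group of a labelling `μ : Fin n → ℕ`**: the subgroup generated by the 3-cycles
`(u v)(v w)` with `u, v, w` distinct and equally labelled — i.e. `∏_i Alt(μ⁻¹ i)` (the form in which
`entropySupportTheorem` delivers stabilising permutations). -/
def blockGroup (μ : Fin n → ℕ) : Subgroup (Equiv.Perm (Fin n)) :=
  Subgroup.closure {σ | ∃ u v w : Fin n, u ≠ v ∧ v ≠ w ∧ u ≠ w ∧ μ u = μ v ∧ μ v = μ w ∧
    σ = Equiv.swap u v * Equiv.swap v w}

/-- **Entropy at most `K n`**: the multinomial of the label classes is at most `2^{Kn}`, in the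
product form of `entropySupportTheorem`: `n! ≤ 2^{Kn} · ∏_i |μ⁻¹ i|!`. -/
def IsLowEntropy (K : ℕ) (μ : Fin n → ℕ) : Prop :=
  n.factorial ≤ 2 ^ (K * n) *
    ∏ i ∈ Finset.univ.image μ, ((Finset.univ.filter fun u : Fin n => μ u = i).card).factorial

/-- The constant labelling (one block) has entropy `0 ≤ K n`. -/
theorem isLowEntropy_const (K : ℕ) : IsLowEntropy K (fun _ : Fin n => 0) := by
  unfold IsLowEntropy
  cases n with
  | zero => simp
  | succ k =>
    have himg : (Finset.univ : Finset (Fin (k + 1))).image (fun _ => (0 : ℕ)) = {0} :=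
      Finset.image_const Finset.univ_nonempty 0
    rw [himg, Finset.prod_singleton, Finset.filter_true_of_mem (fun _ _ => rfl), Finset.card_univ,
      Fintype.card_fin]
    exact Nat.le_mul_of_pos_left _ (Nat.two_pow_pos _)

/-! ### The entropy game -/

/-- **An entropy-`K` coset game between `G` and `H`** (graphs on `Fin n`).  Positions: a
relabelling `β` of `G` against a relabelling `β'` of `H`, typed either by a labelling `μ` ("block
position": only the coset `β · blockGroup μ` — an oriented ordered partition of `V(G)` — is meant to
matter) or by an input pair `q = (p, p')` ("point position": only `(β p, β p')` is meant to matter).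
Conditions: point positions preserve adjacency; the trivial block position is inhabited; and from a
related block position of entropy `≤ K n`, for every next type (block of entropy `≤ K n`, or point)
Duplicator has a bijection `e` of `blockGroup μ` carrying `β ρ` to a related `β' (e ρ)`. -/
structure EntropyGame (K : ℕ) (G H : SimpleGraph (Fin n)) where
  /-- Relatedness at block positions of type `μ`. -/
  R : (Fin n → ℕ) → Equiv.Perm (Fin n) → Equiv.Perm (Fin n) → Prop
  /-- Relatedness at point positions of type `q`. -/
  P : Fin n × Fin n → Equiv.Perm (Fin n) → Equiv.Perm (Fin n) → Prop
  /-- Point positions are partial isomorphisms on the pair read. -/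
  adj : ∀ (q : Fin n × Fin n) (β β' : Equiv.Perm (Fin n)), P q β β' →
    (G.Adj (β q.1) (β q.2) ↔ H.Adj (β' q.1) (β' q.2))
  /-- The one-block position is inhabited. -/
  init : ∃ β β' : Equiv.Perm (Fin n), R (fun _ => 0) β β'
  /-- Block-to-block moves. -/
  stepR : ∀ μ ν : Fin n → ℕ, IsLowEntropy K μ → IsLowEntropy K ν →
    ∀ β β' : Equiv.Perm (Fin n), R μ β β' →
      ∃ e : blockGroup μ ≃ blockGroup μ, ∀ ρ : blockGroup μ, R ν (β * ρ) (β' * e ρ)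
  /-- Block-to-point moves. -/
  stepP : ∀ (μ : Fin n → ℕ) (q : Fin n × Fin n), IsLowEntropy K μ →
    ∀ β β' : Equiv.Perm (Fin n), R μ β β' →
      ∃ e : blockGroup μ ≃ blockGroup μ, ∀ ρ : blockGroup μ, P q (β * ρ) (β' * e ρ)

/-- Entropy games are antitone in `K` (fewer types to answer for). -/
def EntropyGame.mono {K K' : ℕ} {G H : SimpleGraph (Fin n)} (g : EntropyGame K' G H) (hK : K ≤ K') :
    EntropyGame K G H where
  R := g.R
  P := g.P
  adj := g.adj
  init := g.init
  stepR μ ν hμ hν β β' h := g.stepR μ ν (hμ.trans (Nat.mul_le_mul_right _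
    (Nat.pow_le_pow_right Nat.two_pos (Nat.mul_le_mul_right _ hK)))) (hν.trans (Nat.mul_le_mul_right _
    (Nat.pow_le_pow_right Nat.two_pos (Nat.mul_le_mul_right _ hK)))) β β' h
  stepP μ q hμ β β' h := g.stepP μ q (hμ.trans (Nat.mul_le_mul_right _
    (Nat.pow_le_pow_right Nat.two_pos (Nat.mul_le_mul_right _ hK)))) β β' h

/-- **Non-vacuity / isomorphism invariance**: isomorphic graphs admit an entropy game for every `K`
(relate `β` with `π ∘ β`; all moves are the identity bijection).  So `EntropyGame K` is an
isomorphism-invariant notion of similarity, trivial exactly where it must be. -/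
def EntropyGame.ofIso (K : ℕ) {G H : SimpleGraph (Fin n)} (π : G ≃g H) : EntropyGame K G H where
  R _ β β' := β' = π.toEquiv * β
  P _ β β' := β' = π.toEquiv * β
  adj q β β' h := by
    subst h
    rw [Equiv.Perm.mul_apply, Equiv.Perm.mul_apply]
    exact π.map_adj_iff.symm
  init := ⟨1, π.toEquiv * 1, rfl⟩
  stepR μ ν _ _ β β' h := ⟨Equiv.refl _, fun ρ => by subst h; rw [Equiv.refl_apply, mul_assoc]⟩
  stepP μ q _ β β' h := ⟨Equiv.refl _, fun ρ => by subst h; rw [Equiv.refl_apply, mul_assoc]⟩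

/-- **Entropy games fool the window.**  For every rate `c` there is `K` (the constant of
`entropySupportTheorem`) such that an entropy-`K` game between `G` and `H` forces every
`Sym(Fin n)`-symmetric `tcBasis`-circuit with at most `2^{cn}` gates to accept the adjacency matrix of
`G` iff it accepts that of `H`.  Proof: the automorphism-stabiliser of each gate has index `≤ 2^{cn}`
(`index_autStab_le`), so by the entropy support theorem it contains the block group of a labelling of
entropy `≤ K n` (at the output gate: of the constant labelling); run `CosetGame.eval_eq_of_game` with
these groups, the game's relations as `R`, and its bijections as the moves. -/
theorem eval_eq_of_entropyGame (c : ℕ) : ∃ K : ℕ, ∀ (n : ℕ) (G H : SimpleGraph (Fin n))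
    [DecidableRel G.Adj] [DecidableRel H.Adj], Nonempty (EntropyGame K G H) →
    ∀ C : Circuit (Fin n × Fin n), C.IsOver tcBasis → C.IsSymmetricUnder Set.univ →
      C.size ≤ 2 ^ (c * n) → C.eval (adjInput G) = C.eval (adjInput H) := by
  obtain ⟨K, hK⟩ := entropySupportTheorem c
  refine ⟨K, fun n G H _ _ hgame C hB hsymC hsize => ?_⟩
  obtain ⟨game⟩ := hgame
  classical
  -- the entropy support theorem at every gate
  have hidx : ∀ j : Fin C.gates.length, (autStab C j).index ≤ 2 ^ (c * n) := fun j =>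
    (index_autStab_le C hsymC j).trans hsize
  choose μ hμent hμmem using fun j : Fin C.gates.length => hK n (autStab C j) (hidx j)
  -- types: the support labelling, except the constant labelling at the output gate / out of range
  let τ : ℕ → (Fin n → ℕ) := fun j =>
    if h : j < C.gates.length then (if C.output = Sum.inr j then fun _ => 0 else μ ⟨j, h⟩)
    else fun _ => 0
  have hτent : ∀ j, IsLowEntropy K (τ j) := by
    intro j
    simp only [τ]
    split_ifs with h hout
    · exact isLowEntropy_const K
    · exact hμent ⟨j, h⟩
    · exact isLowEntropy_const K
  have hτstab : ∀ (j : ℕ) (hj : j < C.gates.length), blockGroup (τ j) ≤ autStab C ⟨j, hj⟩ := by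
    intro j hj
    by_cases hout : C.output = Sum.inr j
    · rw [autStab_output C hsymC (j := ⟨j, hj⟩) hout]
      exact le_top
    · have hτj : τ j = μ ⟨j, hj⟩ := by simp only [τ, dif_pos hj, if_neg hout]
      rw [hτj, blockGroup]
      refine (Subgroup.closure_le _).2 ?_
      rintro σ ⟨u, v, w, huv, hvw, huw, h1, h2, rfl⟩
      exact hμmem ⟨j, hj⟩ u v w huv hvw huw h1 h2
  refine eval_eq_of_game hB hsymC (fun j => blockGroup (τ j)) ?_
    (Sum.elim game.P fun j => game.R (τ j)) ?_ ?_ ?_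
  · intro j hj ρ hρ
    exact (mem_autStab_iff C ⟨j, hj⟩ ρ).1 (hτstab j hj hρ)
  · intro q β β' hP
    exact game.adj q β β' hP
  · intro j hj i β β' hR
    change game.R (τ j) β β' at hR
    generalize hw : (C.gates[j]).args i = w
    cases w with
    | inl q =>
      obtain ⟨e, he⟩ := game.stepP (τ j) q (hτent j) β β' hR
      exact ⟨e, he⟩
    | inr m =>
      obtain ⟨e, he⟩ := game.stepR (τ j) (τ m) (hτent j) (hτent m) β β' hR
      exact ⟨e, he⟩
  · intro j hout
    have hj : j < C.gates.length := C.wf_output j hout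
    obtain ⟨β, β', hββ'⟩ := game.init
    refine ⟨β, β', ?_⟩
    change game.R (τ j) β β'
    have hτj : τ j = fun _ => 0 := by simp only [τ, dif_pos hj, if_pos hout]
    rw [hτj]
    exact hββ'

/-- `eval_eq_of_entropyGame` on the literal adjacency inputs `fun p => [G.Adj p.1 p.2]` with the
classical decidability instances — the input convention of the crux files ((★) CoreFooling,
`hardToIdentify_of_coreFooling`), hypotheses in `HasSymCircuit` order. -/
theorem eval_eq_of_entropyGame' (c : ℕ) : ∃ K : ℕ, ∀ (n : ℕ) (G H : SimpleGraph (Fin n)),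
    Nonempty (EntropyGame K G H) →
    ∀ C : Circuit (Fin n × Fin n), C.IsOver tcBasis → C.size ≤ 2 ^ (c * n) →
      C.IsSymmetricUnder Set.univ →
        C.eval (fun p : Fin n × Fin n => @decide (G.Adj p.1 p.2) (Classical.propDecidable _)) =
          C.eval (fun p : Fin n × Fin n => @decide (H.Adj p.1 p.2) (Classical.propDecidable _)) := by
  obtain ⟨K, hK⟩ := eval_eq_of_entropyGame c
  refine ⟨K, fun n G H hgame C hB hsize hsymC => ?_⟩
  exact @hK n G H (fun _ _ => Classical.propDecidable _) (fun _ _ => Classical.propDecidable _) hgame C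
    hB hsymC hsize

end CosetGame

open CosetGame
open scoped Classical

/-- **Entropy games for every `K` give (★) CoreFooling** (the hypothesis of the landed
`stub_coreReduction` / `hardToIdentify_of_coreFooling` / `windowBarrier_of_coreFooling`): if for every
`K`, infinitely often two non-isomorphic graphs on `Fin n` admit an entropy-`K` game, then for every
`d`, infinitely often two non-isomorphic graphs fool all `Sym(Fin n)`-symmetric `tcBasis`-circuits of
size `≤ 2^{dn}`. -/
theorem coreFooling_of_entropyGames :
    (∀ K : ℕ, ∃ᶠ n in atTop, ∃ G H : SimpleGraph (Fin n),
      ¬ Nonempty (G ≃g H) ∧ Nonempty (CosetGame.EntropyGame K G H)) →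
    ∀ d : ℕ, ∃ᶠ g in atTop, ∃ G₁ G₂ : SimpleGraph (Fin g), ¬ Nonempty (G₁ ≃g G₂) ∧
      ∀ C : Circuit (Fin g × Fin g), C.IsOver tcBasis → C.size ≤ 2 ^ (d * g) →
        C.IsSymmetricUnder Set.univ →
          C.eval (fun p : Fin g × Fin g => decide (G₁.Adj p.1 p.2)) =
            C.eval (fun p : Fin g × Fin g => decide (G₂.Adj p.1 p.2)) := by
  intro h d
  obtain ⟨K, hK⟩ := eval_eq_of_entropyGame' d
  refine (h K).mono ?_
  rintro n ⟨G, H, hGH, hgame⟩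
  exact ⟨G, H, hGH, fun C hB hsize hsymC => hK n G H hgame C hB hsize hsymC⟩

/-- **Entropy games for every `K` give HardToIdentify** (the open core `stub_hardToIdentify` of
crux stmt-PneNP-2145, line `bijection-gauge-twin-iso`), via `hardToIdentify_of_coreFooling`. -/
theorem hardToIdentify_of_entropyGames
    (h : ∀ K : ℕ, ∃ᶠ n in atTop, ∃ G H : SimpleGraph (Fin n),
      ¬ Nonempty (G ≃g H) ∧ Nonempty (EntropyGame K G H)) :
    ∀ c : ℕ, ∃ᶠ h in atTop, ∃ H : SimpleGraph (Fin h),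
      ¬ HasSymCircuit tcBasis Set.univ (2 ^ (c * h))
        (fun x : Fin h × Fin h → Bool =>
          decide (Nonempty ((SimpleGraph.fromRel fun u v => x (u, v) = true) ≃g H))) :=
  hardToIdentify_of_coreFooling (coreFooling_of_entropyGames h)

/-- **Entropy games for every `K`, with Babai–Luks canonical forms, give `WindowBarrier`** (and
hence refute `NoHiddenOrder`, stmt-PneNP-14781, its literal negation): the crux's S-side is now
EXACTLY {`babaiLuks1983_canonicalForm`, a Duplicator strategy in the entropy game for every `K`},
by `windowBarrier_of_coreFooling`. -/
theorem windowBarrier_of_entropyGames (hBL : babaiLuks1983_canonicalForm)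
    (h : ∀ K : ℕ, ∃ᶠ n in atTop, ∃ G H : SimpleGraph (Fin n),
      ¬ Nonempty (G ≃g H) ∧ Nonempty (EntropyGame K G H)) :
    Summit.PneNP.PneNP.Theses.SymmetryBudget.WindowBarrier :=
  windowBarrier_of_coreFooling hBL (coreFooling_of_entropyGames h)

/-- **… and hence refute `NoHiddenOrder`** (crux stmt-PneNP-14781, the literal negation of
`WindowBarrier`, tree bridge `noHiddenOrder_iff_not_windowBarrier`): with Babai–Luks canonical forms,
entropy games for every `K` on infinitely many non-isomorphic pairs falsify "no hidden order at
scale `log m`". -/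
theorem not_noHiddenOrder_of_entropyGames (hBL : babaiLuks1983_canonicalForm)
    (h : ∀ K : ℕ, ∃ᶠ n in atTop, ∃ G H : SimpleGraph (Fin n),
      ¬ Nonempty (G ≃g H) ∧ Nonempty (EntropyGame K G H)) :
    ¬ Summit.PneNP.PneNP.Theses.SymmetryBudget.NoHiddenOrder := fun hN =>
  noHiddenOrder_iff_not_windowBarrier.1 hN (windowBarrier_of_entropyGames hBL h)

end Summit.PneNP.PneNP.Theorems
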